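import Mathlib
import HarnessLib
import Summits.HubbardSuperconductivity.HubbardSuperconductivity.Theorems.KLProgrammeKLRegimeEnginePairTransferMemberFlow
import Summits.HubbardSuperconductivity.HubbardSuperconductivity.Theorems.KLProgrammeKLRegimeEngineV8PairTransferRelBarIdx
import Summits.HubbardSuperconductivity.HubbardSuperconductivity.Theorems.KLProgrammeKLRegimeSplitEdgeFactsComplFamily

/-!
# Route `KLProgramme` — ENGINE child gen 8 (stmt-HubbardSuperconductivity-20437 `KLRegimeEngineV17F2`), skeleton v2 class #5 «(S)-transfer» rev 3 (RELATIVE family,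
# INDEX form): the RATE and PROFILE sizes of the member flow, BY NAME — `kltc_norm_sub_le_integral_of_rate`, `kltc_profile_of_rate`, `kltc_sum_norm_le_of_rate`,
# `klmf_sum_norm_rate_le`, `klmf_sum_norm_relRate_le(_idx)` (cell gate-hubbard-kl, seat hubbard-kl-k3c1-p1 g11, technique «composed-map remainder propagation»)

WHY.  In the SIZES bundle of `pairTransferRelAt_succ_keyed` (`…EnginePairTransferRelIdxStep`, p592121) the rate rows `Σ_c‖ḃᵢ(t)_c‖ ≤ β′`, the profile rows
`‖bᵢ(t)_c − bᵢ(0)_c‖ ≤ ρᵢ(c)`, `m·Σρᵢ ≤ 1/3`, and the mass of the relative weight `Σ_c‖a(t)_c‖` along the slice are NOT analytic unknowns: they follow from p1's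
running-weight bounds (`sum_abs_relativeRate_le_softSum`, `…SplitEdgeFactsRunningWeight` p585492) and the soft-mass bounds of admissible symbols
(`klSoftMass_le_of_frameOK`, `klSoftMass_compl_sub_compl_le_klIdxMass`).  This file supplies them:
* §1 generic (finite index): `kltc_norm_sub_le_integral_of_rate` (`‖b(t)_c − b(0)_c‖ ≤ ∫₀¹‖ḃ(s)_c‖ds`), **`kltc_profile_of_rate`** (the integral profile
  `ρ(c) := ∫₀¹‖ḃ(s)_c‖ds` satisfies the profile row AND `Σ_c ρ(c) ≤ β′` from the rate row — so `m·Σρ ≤ 1/3` follows from `m·β′ ≤ 1/3`), **`kltc_sum_norm_le_of_rate`**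
  (`Σ_c‖a(t)_c‖ ≤ Σ_c‖a(0)_c‖ + R` from `Σ_c‖ȧ(s)_c‖ ≤ R`);
* §2 model: `klmf_runningSymbol_mem` (the running symbol of a member admissible at
  `(K, n+1)` is admissible-in-size at scale `n` all along the slice), **`klmf_sum_norm_rate_le`** — `Σ_p‖ḃ(t)(Qm,p)‖ ≤ 2^10·15367` for EVERY member, n-uniformly
  (`FrameOK` frame, `klBetaMin ≤ β ≤ L`): `(Λ_n − Λ_{n+1})·(256/3)/Λ(t)²·Σ|φ_t|‖ĝ‖ ≤ (3/4)·(256/3)·16·15367`; `klmf_rate_sub_eq` + **`klmf_sum_norm_relRate_le`** — the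
  RELATIVE rate has lines of `D = ψ₁ − ψ₂` only and mass `Σ_p‖ḃ₁(t) − ḃ₂(t)‖ ≤ 2^10·klSoftMass K n D`; **`klmf_sum_norm_relRate_le_idx`** — for the cutoff-built pair
  `(s_{n+1,j} | s_{n+1,j′})`, `n+1 ≤ j′ ≤ j`: `≤ 2^10·klIdxMass n j′` (frame-free, the INDEX currency of `transferBarRelIdx`).
Real analysis + the landed mass bounds; nothing about the effective action is asserted; nothing asserts superconductivity.  0 kit.
-/

noncomputable section

namespace Summit.HubbardSuperconductivity.HubbardSuperconductivity.Theorems.KLRegimeSplit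

set_option linter.dupNamespace false -- summit = problem name (single-conjunct summit), D-0017

open Finset Matrix Set Literature.MathematicalPhysics.QuantumLattice Literature.Probability.LatticeModels
open Summit.HubbardSuperconductivity.HubbardSuperconductivity.Theorems.KLProgrammeLegKernels
open Summit.HubbardSuperconductivity.HubbardSuperconductivity.Theorems.DispersionFlow
open Summit.HubbardSuperconductivity.HubbardSuperconductivity.Theorems.KLRegimeWick
open Summit.HubbardSuperconductivity.HubbardSuperconductivity.Theorems.EngineV8
open Summit.HubbardSuperconductivity.HubbardSuperconductivity.Theorems.TwoPointAssembly

/-! ## §1 Rates ⇒ profiles and masses (generic) -/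

section Generic

variable {ι : Type*} [Fintype ι]

/-- **FTC bound**: `‖f(t) − f(0)‖ ≤ ∫₀¹‖f′(s)‖ds` on `[0,1]` for `f` with derivative `f′` on `[0,1]`, `f′` continuous there. -/
theorem kltc_norm_sub_le_integral_of_rate (f f' : ℝ → ℂ) (hf : ∀ t ∈ Icc (0 : ℝ) 1, HasDerivAt f (f' t) t) (hf'c : ContinuousOn f' (Icc 0 1))
    {t : ℝ} (ht : t ∈ Icc (0 : ℝ) 1) : ‖f t - f 0‖ ≤ ∫ s in (0 : ℝ)..1, ‖f' s‖ := by
  have hsub : uIcc (0 : ℝ) t ⊆ Icc 0 1 := by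
    rw [Set.uIcc_of_le ht.1]; exact Icc_subset_Icc_right ht.2
  have hderiv : ∀ s ∈ uIcc (0 : ℝ) t, HasDerivAt f (f' s) s := fun s hs => hf s (hsub hs)
  have hint : IntervalIntegrable f' MeasureTheory.volume 0 t := (hf'c.mono hsub).intervalIntegrable
  have hint1 : IntervalIntegrable f' MeasureTheory.volume 0 1 := (hf'c.mono (by rw [Set.uIcc_of_le zero_le_one])).intervalIntegrable
  rw [← intervalIntegral.integral_eq_sub_of_hasDerivAt hderiv hint]
  calc ‖∫ s in (0 : ℝ)..t, f' s‖ ≤ ∫ s in (0 : ℝ)..t, ‖f' s‖ := intervalIntegral.norm_integral_le_integral_norm ht.1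
    _ ≤ ∫ s in (0 : ℝ)..1, ‖f' s‖ :=
        intervalIntegral.integral_mono_interval le_rfl ht.1 ht.2 (Filter.Eventually.of_forall fun s => norm_nonneg _) hint1.norm

/-- **The integral profile of a rate**: with `ρ(c) := ∫₀¹‖ḃ(s)_c‖ds`, the profile row `‖b(t)_c − b(0)_c‖ ≤ ρ(c)` holds on `[0,1]`, and the rate row `Σ_c‖ḃ(s)_c‖ ≤ β′`
(`s ∈ [0,1]`) gives `Σ_c ρ(c) ≤ β′`. -/
theorem kltc_profile_of_rate (b b' : ℝ → ι → ℂ) (hb : ∀ t ∈ Icc (0 : ℝ) 1, ∀ c, HasDerivAt (fun s => b s c) (b' t c) t)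
    (hb'c : ∀ c, ContinuousOn (fun t => b' t c) (Icc 0 1)) {β' : ℝ} (hβ' : ∀ t ∈ Icc (0 : ℝ) 1, ∑ c, ‖b' t c‖ ≤ β') :
    (∀ t ∈ Icc (0 : ℝ) 1, ∀ c, ‖b t c - b 0 c‖ ≤ ∫ s in (0 : ℝ)..1, ‖b' s c‖) ∧ ∑ c, (∫ s in (0 : ℝ)..1, ‖b' s c‖) ≤ β' := by
  refine ⟨fun t ht c => kltc_norm_sub_le_integral_of_rate (fun s => b s c) (fun s => b' s c) (fun s hs => hb s hs c) (hb'c c) ht, ?_⟩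
  have hint : ∀ c, IntervalIntegrable (fun s => ‖b' s c‖) MeasureTheory.volume 0 1 := fun c =>
    ((hb'c c).norm.mono (by rw [Set.uIcc_of_le zero_le_one])).intervalIntegrable
  rw [← intervalIntegral.integral_finsetSum fun c _ => hint c]
  have hsum : IntervalIntegrable (fun s => ∑ c, ‖b' s c‖) MeasureTheory.volume 0 1 :=
    ((continuousOn_finsetSum Finset.univ fun c _ => (hb'c c).norm).mono (by rw [Set.uIcc_of_le zero_le_one])).intervalIntegrable
  calc ∫ s in (0 : ℝ)..1, ∑ c, ‖b' s c‖ ≤ ∫ _ in (0 : ℝ)..1, β' :=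
        intervalIntegral.integral_mono_on zero_le_one hsum intervalIntegrable_const fun s hs => hβ' s hs
    _ = β' := by rw [intervalIntegral.integral_const]; simp

/-- **Mass along the slice from the start mass and the rate**: `Σ_c‖a(t)_c‖ ≤ Σ_c‖a(0)_c‖ + R` on `[0,1]` whenever `Σ_c‖ȧ(s)_c‖ ≤ R` on `[0,1]`. -/
theorem kltc_sum_norm_le_of_rate (a a' : ℝ → ι → ℂ) (ha : ∀ t ∈ Icc (0 : ℝ) 1, ∀ c, HasDerivAt (fun s => a s c) (a' t c) t)
    (ha'c : ∀ c, ContinuousOn (fun t => a' t c) (Icc 0 1)) {R : ℝ} (hR : ∀ t ∈ Icc (0 : ℝ) 1, ∑ c, ‖a' t c‖ ≤ R)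
    {t : ℝ} (ht : t ∈ Icc (0 : ℝ) 1) : ∑ c, ‖a t c‖ ≤ ∑ c, ‖a 0 c‖ + R := by
  obtain ⟨hprof, hsum⟩ := kltc_profile_of_rate a a' ha ha'c hR
  calc ∑ c, ‖a t c‖ ≤ ∑ c, (‖a 0 c‖ + ‖a t c - a 0 c‖) := sum_le_sum fun c _ => norm_le_insert' _ _
    _ = ∑ c, ‖a 0 c‖ + ∑ c, ‖a t c - a 0 c‖ := sum_add_distrib
    _ ≤ ∑ c, ‖a 0 c‖ + ∑ c, (∫ s in (0 : ℝ)..1, ‖a' s c‖) := by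
        gcongr with c _; exact hprof t ht c
    _ ≤ ∑ c, ‖a 0 c‖ + R := by gcongr

end Generic

/-! ## §2 The model's rates: every member, and the relative rate in soft-mass / index currency -/

section Model

variable (L M : ℕ) (β μ : ℝ) (K : TrigPolyC4v)

/-- **The running symbol of an admissible member stays admissible-in-size at scale `n`**: for `0 ≤ ψ ≤ 1 − w_{Λ_{n+1}}` and `t ∈ [0,1]`,
`0 ≤ φ_{Λ(t)} ≤ 1 − w_{Λ_n}` pointwise (`Λ(t) ∈ [Λ_{n+1}, Λ_n]`). -/
theorem klmf_runningSymbol_mem (n : ℕ) {ψ : FreqMomentum L M → ℝ}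
    (hψ : ∀ k, 0 ≤ ψ k ∧ ψ k ≤ 1 - hubbardCutoffWeightCT L M β μ K (klScale klE0 (n + 1)) k) {t : ℝ} (ht : t ∈ Icc (0 : ℝ) 1)
    (k : FreqMomentum L M) :
    0 ≤ ψ k + (hubbardCutoffWeightCT L M β μ K (klScale klE0 (n + 1)) k -
        hubbardCutoffWeightCT L M β μ K (klScale klE0 n + t * (klScale klE0 (n + 1) - klScale klE0 n)) k) ∧
      ψ k + (hubbardCutoffWeightCT L M β μ K (klScale klE0 (n + 1)) k -
        hubbardCutoffWeightCT L M β μ K (klScale klE0 n + t * (klScale klE0 (n + 1) - klScale klE0 n)) k) ≤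
        1 - hubbardCutoffWeightCT L M β μ K (klScale klE0 n) k := by
  have h10 := (klmf_klScale_succ_pos_le n).2
  have h1 := (klmf_klScale_succ_pos_le n).1
  have hmem := klws_affine_mem_Icc h10 ht
  have hlow := klws_cutoffWeight_anti_scale L M β μ K h1 hmem.1 k          -- `w_{Λ(t)} ≤ w_{Λ_{n+1}}`
  have hup := klws_cutoffWeight_anti_scale L M β μ K (h1.trans_le hmem.1) hmem.2 k   -- `w_{Λ_n} ≤ w_{Λ(t)}`
  constructor
  · linarith [(hψ k).1]
  · linarith [(hψ k).2]

variable [NeZero L] {R : RenConsts} {U : ℝ} {N : ℕ}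

/-- **Rate mass of ANY admissible member, n-uniform**: along slice `n+1`, for `ψ` admissible-in-size at `(K, n+1)`, a `FrameOK` frame and `klBetaMin ≤ β ≤ L`,
`Σ_p ‖ḃ(t)(Qm,p)‖ ≤ 2^10·15367` (`ḃ` of `klmf_rung_data`; `(Λ_n − Λ_{n+1})·(256/3)/Λ(t)²·Σ_k|φ_t(k)|‖ĝ_K(k)‖`, soft mass `≤ 15367·Λ_n·βL²`, `Λ(t) ≥ Λ_n/4`). -/
theorem klmf_sum_norm_rate_le (hK : FrameOK R U N μ K) (hβ : klBetaMin ≤ β) (hβL : β ≤ L) (n : ℕ) {ψ : FreqMomentum L M → ℝ}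
    (hψ : ∀ k, 0 ≤ ψ k ∧ ψ k ≤ 1 - hubbardCutoffWeightCT L M β μ K (klScale klE0 (n + 1)) k) (Qm : TorusSite 2 L) {t : ℝ} (ht : t ∈ Icc (0 : ℝ) 1) :
    ∑ p, ‖((((klScale klE0 (n + 1) - klScale klE0 n) *
        (klBubbleMass L M β μ K
            (fun k => deriv (fun Λ' => hubbardCutoffWeightCT L M β μ K Λ' k) (klScale klE0 n + t * (klScale klE0 (n + 1) - klScale klE0 n)))
            (fun k => ψ k + (hubbardCutoffWeightCT L M β μ K (klScale klE0 (n + 1)) k -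
              hubbardCutoffWeightCT L M β μ K (klScale klE0 n + t * (klScale klE0 (n + 1) - klScale klE0 n)) k)) Qm p +
          klBubbleMass L M β μ K
            (fun k => ψ k + (hubbardCutoffWeightCT L M β μ K (klScale klE0 (n + 1)) k -
              hubbardCutoffWeightCT L M β μ K (klScale klE0 n + t * (klScale klE0 (n + 1) - klScale klE0 n)) k))
            (fun k => deriv (fun Λ' => hubbardCutoffWeightCT L M β μ K Λ' k) (klScale klE0 n + t * (klScale klE0 (n + 1) - klScale klE0 n)))
            Qm p) : ℝ)) : ℂ)‖ ≤ (2 : ℝ) ^ 10 * 15367 := by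
  have hβ0 : 0 < β := pos_of_klBetaMin_le hβ
  have hL : (0 : ℝ) < L := hβ0.trans_le hβL
  have h10 := (klmf_klScale_succ_pos_le n).2
  have h1 := (klmf_klScale_succ_pos_le n).1
  have hΛn : 0 < klScale klE0 n := klth_klScale_pos n
  have hsucc : klScale klE0 (n + 1) = klScale klE0 n / 4 := klth_klScale_succ n
  set Λt : ℝ := klScale klE0 n + t * (klScale klE0 (n + 1) - klScale klE0 n) with hΛt_def
  have hmem : Λt ∈ Icc (klScale klE0 (n + 1)) (klScale klE0 n) := klws_affine_mem_Icc h10 ht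
  have hΛt : 0 < Λt := h1.trans_le hmem.1
  set φ : FreqMomentum L M → ℝ := fun k => ψ k + (hubbardCutoffWeightCT L M β μ K (klScale klE0 (n + 1)) k -
    hubbardCutoffWeightCT L M β μ K Λt k) with hφ_def
  -- the relative-rate mass bound with `D := φ_t` and the soft mass of `φ_t` at scale `n`
  have hrate := sum_abs_relativeRate_le_softSum (L := L) (M := M) β μ K hβ0 hΛt φ Qm
  have hφn : ∀ k, 0 ≤ φ k ∧ φ k ≤ 1 - hubbardCutoffWeightCT L M β μ K (klScale klE0 n) k := fun k =>
    klmf_runningSymbol_mem L M β μ K n hψ ht k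
  have hsm := klSoftMass_le_of_frameOK (L := L) (M := M) (β := β) (μ := μ) (K := K) hK hβ hβL n hφn
  have hsoft : ∑ k : FreqMomentum L M, |φ k| * ‖propCT L M β μ K k‖ ≤ 15367 * (klScale klE0 n * (β * (L : ℝ) ^ 2)) := by
    unfold klSoftMass at hsm
    have hpos : 0 < klScale klE0 n * (β * (L : ℝ) ^ 2) := by positivity
    have h := (inv_mul_le_iff₀ hpos).1 hsm
    linarith [h]
  -- termwise: `‖((c·x : ℝ) : ℂ)‖ = |c|·|x|`
  have hterm : ∀ p, ‖((((klScale klE0 (n + 1) - klScale klE0 n) *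
      (klBubbleMass L M β μ K (fun k => deriv (fun Λ' => hubbardCutoffWeightCT L M β μ K Λ' k) Λt) φ Qm p +
        klBubbleMass L M β μ K φ (fun k => deriv (fun Λ' => hubbardCutoffWeightCT L M β μ K Λ' k) Λt) Qm p) : ℝ)) : ℂ)‖ =
      (klScale klE0 n - klScale klE0 (n + 1)) *
        |klBubbleMass L M β μ K (fun k => deriv (fun Λ' => hubbardCutoffWeightCT L M β μ K Λ' k) Λt) φ Qm p +
          klBubbleMass L M β μ K φ (fun k => deriv (fun Λ' => hubbardCutoffWeightCT L M β μ K Λ' k) Λt) Qm p| := by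
    intro p
    rw [Complex.norm_real, Real.norm_eq_abs, abs_mul, abs_of_nonpos (by linarith [hmem.1, hmem.2, h10]), neg_sub]
  simp only [hterm, ← Finset.mul_sum]
  have hdiff : 0 ≤ klScale klE0 n - klScale klE0 (n + 1) := by linarith
  calc (klScale klE0 n - klScale klE0 (n + 1)) *
        ∑ p, |klBubbleMass L M β μ K (fun k => deriv (fun Λ' => hubbardCutoffWeightCT L M β μ K Λ' k) Λt) φ Qm p +
          klBubbleMass L M β μ K φ (fun k => deriv (fun Λ' => hubbardCutoffWeightCT L M β μ K Λ' k) Λt) Qm p|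
      ≤ (klScale klE0 n - klScale klE0 (n + 1)) *
          ((β * (L : ℝ) ^ 2)⁻¹ * (256 / 3 / Λt ^ 2) * (15367 * (klScale klE0 n * (β * (L : ℝ) ^ 2)))) := by
        refine mul_le_mul_of_nonneg_left (hrate.trans ?_) hdiff
        exact mul_le_mul_of_nonneg_left hsoft (by positivity)
    _ = 256 / 3 * 15367 * ((klScale klE0 n - klScale klE0 (n + 1)) * klScale klE0 n / Λt ^ 2) := by
        field_simp
    _ ≤ 256 / 3 * 15367 * ((klScale klE0 n - klScale klE0 (n + 1)) * klScale klE0 n / (klScale klE0 (n + 1)) ^ 2) :=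
        mul_le_mul_of_nonneg_left (div_le_div_of_nonneg_left (by positivity) (by positivity) (pow_le_pow_left₀ h1.le hmem.1 2))
          (by norm_num)
    _ = (2 : ℝ) ^ 10 * 15367 := by
        rw [hsucc]
        field_simp
        ring

omit [NeZero L] in
/-- **The relative rate has lines of the difference symbol only** (bilinearity): `ḃ₁(t) − ḃ₂(t) = (Λ_{n+1} − Λ_n)·(B(ẇ_{Λ(t)}, D) + B(D, ẇ_{Λ(t)}))`, `D = ψ₁ − ψ₂`. -/
theorem klmf_rate_sub_eq (n : ℕ) (ψ₁ ψ₂ : FreqMomentum L M → ℝ) (Qm p : TorusSite 2 L) (t : ℝ) :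
    ((((klScale klE0 (n + 1) - klScale klE0 n) *
        (klBubbleMass L M β μ K
            (fun k => deriv (fun Λ' => hubbardCutoffWeightCT L M β μ K Λ' k) (klScale klE0 n + t * (klScale klE0 (n + 1) - klScale klE0 n)))
            (fun k => ψ₁ k + (hubbardCutoffWeightCT L M β μ K (klScale klE0 (n + 1)) k -
              hubbardCutoffWeightCT L M β μ K (klScale klE0 n + t * (klScale klE0 (n + 1) - klScale klE0 n)) k)) Qm p +
          klBubbleMass L M β μ K
            (fun k => ψ₁ k + (hubbardCutoffWeightCT L M β μ K (klScale klE0 (n + 1)) k -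
              hubbardCutoffWeightCT L M β μ K (klScale klE0 n + t * (klScale klE0 (n + 1) - klScale klE0 n)) k))
            (fun k => deriv (fun Λ' => hubbardCutoffWeightCT L M β μ K Λ' k) (klScale klE0 n + t * (klScale klE0 (n + 1) - klScale klE0 n)))
            Qm p) : ℝ)) : ℂ) -
      ((((klScale klE0 (n + 1) - klScale klE0 n) *
        (klBubbleMass L M β μ K
            (fun k => deriv (fun Λ' => hubbardCutoffWeightCT L M β μ K Λ' k) (klScale klE0 n + t * (klScale klE0 (n + 1) - klScale klE0 n)))
            (fun k => ψ₂ k + (hubbardCutoffWeightCT L M β μ K (klScale klE0 (n + 1)) k -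
              hubbardCutoffWeightCT L M β μ K (klScale klE0 n + t * (klScale klE0 (n + 1) - klScale klE0 n)) k)) Qm p +
          klBubbleMass L M β μ K
            (fun k => ψ₂ k + (hubbardCutoffWeightCT L M β μ K (klScale klE0 (n + 1)) k -
              hubbardCutoffWeightCT L M β μ K (klScale klE0 n + t * (klScale klE0 (n + 1) - klScale klE0 n)) k))
            (fun k => deriv (fun Λ' => hubbardCutoffWeightCT L M β μ K Λ' k) (klScale klE0 n + t * (klScale klE0 (n + 1) - klScale klE0 n)))
            Qm p) : ℝ)) : ℂ) =
      ((((klScale klE0 (n + 1) - klScale klE0 n) *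
        (klBubbleMass L M β μ K
            (fun k => deriv (fun Λ' => hubbardCutoffWeightCT L M β μ K Λ' k) (klScale klE0 n + t * (klScale klE0 (n + 1) - klScale klE0 n)))
            (ψ₁ - ψ₂) Qm p +
          klBubbleMass L M β μ K (ψ₁ - ψ₂)
            (fun k => deriv (fun Λ' => hubbardCutoffWeightCT L M β μ K Λ' k) (klScale klE0 n + t * (klScale klE0 (n + 1) - klScale klE0 n)))
            Qm p) : ℝ)) : ℂ) := by
  set Λt : ℝ := klScale klE0 n + t * (klScale klE0 (n + 1) - klScale klE0 n)
  have hD : (ψ₁ - ψ₂ : FreqMomentum L M → ℝ) =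
      (fun k => ψ₁ k + (hubbardCutoffWeightCT L M β μ K (klScale klE0 (n + 1)) k - hubbardCutoffWeightCT L M β μ K Λt k)) +
        -(fun k => ψ₂ k + (hubbardCutoffWeightCT L M β μ K (klScale klE0 (n + 1)) k - hubbardCutoffWeightCT L M β μ K Λt k)) := by
    funext k; simp; ring
  rw [hD, klBubbleMass_add_right, klBubbleMass_add_left, klBubbleMass_neg_right, klBubbleMass_neg_left]
  push_cast
  ring

/-- **Relative rate mass in soft-mass currency**: `Σ_p ‖ḃ₁(t) − ḃ₂(t)‖ ≤ 2^10·klSoftMass K n (ψ₁ − ψ₂)` (`0 < β`; every `t ∈ [0,1]`). -/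
theorem klmf_sum_norm_relRate_le (hβ : 0 < β) (n : ℕ) (ψ₁ ψ₂ : FreqMomentum L M → ℝ) (Qm : TorusSite 2 L) {t : ℝ} (ht : t ∈ Icc (0 : ℝ) 1) :
    ∑ p, ‖((((klScale klE0 (n + 1) - klScale klE0 n) *
        (klBubbleMass L M β μ K
            (fun k => deriv (fun Λ' => hubbardCutoffWeightCT L M β μ K Λ' k) (klScale klE0 n + t * (klScale klE0 (n + 1) - klScale klE0 n)))
            (ψ₁ - ψ₂) Qm p +
          klBubbleMass L M β μ K (ψ₁ - ψ₂)
            (fun k => deriv (fun Λ' => hubbardCutoffWeightCT L M β μ K Λ' k) (klScale klE0 n + t * (klScale klE0 (n + 1) - klScale klE0 n)))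
            Qm p) : ℝ)) : ℂ)‖ ≤ (2 : ℝ) ^ 10 * klSoftMass L M β μ K n (ψ₁ - ψ₂) := by
  have h10 := (klmf_klScale_succ_pos_le n).2
  have h1 := (klmf_klScale_succ_pos_le n).1
  have hΛn : 0 < klScale klE0 n := klth_klScale_pos n
  have hL : (0 : ℝ) < L := by have := NeZero.pos L; exact_mod_cast this
  have hsucc : klScale klE0 (n + 1) = klScale klE0 n / 4 := klth_klScale_succ n
  set Λt : ℝ := klScale klE0 n + t * (klScale klE0 (n + 1) - klScale klE0 n) with hΛt_def
  have hmem : Λt ∈ Icc (klScale klE0 (n + 1)) (klScale klE0 n) := klws_affine_mem_Icc h10 ht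
  have hΛt : 0 < Λt := h1.trans_le hmem.1
  have hrate := sum_abs_relativeRate_le_softSum (L := L) (M := M) β μ K hβ hΛt (ψ₁ - ψ₂) Qm
  have hsoft : ∑ k : FreqMomentum L M, |(ψ₁ - ψ₂) k| * ‖propCT L M β μ K k‖ =
      klSoftMass L M β μ K n (ψ₁ - ψ₂) * (klScale klE0 n * (β * (L : ℝ) ^ 2)) := by
    unfold klSoftMass
    have hpos : klScale klE0 n * (β * (L : ℝ) ^ 2) ≠ 0 := by positivity
    field_simp
  have hterm : ∀ p, ‖((((klScale klE0 (n + 1) - klScale klE0 n) *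
      (klBubbleMass L M β μ K (fun k => deriv (fun Λ' => hubbardCutoffWeightCT L M β μ K Λ' k) Λt) (ψ₁ - ψ₂) Qm p +
        klBubbleMass L M β μ K (ψ₁ - ψ₂) (fun k => deriv (fun Λ' => hubbardCutoffWeightCT L M β μ K Λ' k) Λt) Qm p) : ℝ)) : ℂ)‖ =
      (klScale klE0 n - klScale klE0 (n + 1)) *
        |klBubbleMass L M β μ K (fun k => deriv (fun Λ' => hubbardCutoffWeightCT L M β μ K Λ' k) Λt) (ψ₁ - ψ₂) Qm p +
          klBubbleMass L M β μ K (ψ₁ - ψ₂) (fun k => deriv (fun Λ' => hubbardCutoffWeightCT L M β μ K Λ' k) Λt) Qm p| := by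
    intro p
    rw [Complex.norm_real, Real.norm_eq_abs, abs_mul, abs_of_nonpos (by linarith [hmem.1, hmem.2, h10]), neg_sub]
  simp only [hterm, ← Finset.mul_sum]
  have hdiff : 0 ≤ klScale klE0 n - klScale klE0 (n + 1) := by linarith
  have hms : 0 ≤ klSoftMass L M β μ K n (ψ₁ - ψ₂) := klSoftMass_nonneg β μ K hβ n _
  calc (klScale klE0 n - klScale klE0 (n + 1)) *
        ∑ p, |klBubbleMass L M β μ K (fun k => deriv (fun Λ' => hubbardCutoffWeightCT L M β μ K Λ' k) Λt) (ψ₁ - ψ₂) Qm p +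
          klBubbleMass L M β μ K (ψ₁ - ψ₂) (fun k => deriv (fun Λ' => hubbardCutoffWeightCT L M β μ K Λ' k) Λt) Qm p|
      ≤ (klScale klE0 n - klScale klE0 (n + 1)) *
          ((β * (L : ℝ) ^ 2)⁻¹ * (256 / 3 / Λt ^ 2) * (klSoftMass L M β μ K n (ψ₁ - ψ₂) * (klScale klE0 n * (β * (L : ℝ) ^ 2)))) := by
        refine mul_le_mul_of_nonneg_left ?_ hdiff
        rw [← hsoft]; exact hrate
    _ = 256 / 3 * klSoftMass L M β μ K n (ψ₁ - ψ₂) * ((klScale klE0 n - klScale klE0 (n + 1)) * klScale klE0 n / Λt ^ 2) := by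
        field_simp
    _ ≤ 256 / 3 * klSoftMass L M β μ K n (ψ₁ - ψ₂) * ((klScale klE0 n - klScale klE0 (n + 1)) * klScale klE0 n / (klScale klE0 (n + 1)) ^ 2) :=
        mul_le_mul_of_nonneg_left (div_le_div_of_nonneg_left (by positivity) (by positivity) (pow_le_pow_left₀ h1.le hmem.1 2))
          (by positivity)
    _ = (2 : ℝ) ^ 10 * klSoftMass L M β μ K n (ψ₁ - ψ₂) := by
        rw [hsucc]
        field_simp
        ring

/-- **Relative rate mass in INDEX currency** for the cutoff-built pair `(s_{n+1,j} | s_{n+1,j′})`, `n+1 ≤ j′ ≤ j` (`FrameOK` frame, `klBetaMin ≤ β ≤ L`):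
`Σ_p ‖ḃ_j(t) − ḃ_{j′}(t)‖ ≤ 2^10·klIdxMass n j′` — the difference symbol is `s_{j′,j} = s_{n,j} − s_{n,j′}` (`softSymbolCompl_sub_compl_eq_sub`), whose soft mass at scale `n`
is below the index mass (`klSoftMass_compl_sub_compl_le_klIdxMass`). -/
theorem klmf_sum_norm_relRate_le_idx (hK : FrameOK R U N μ K) (hβ : klBetaMin ≤ β) (hβL : β ≤ L) {n j j' : ℕ} (hn : n + 1 ≤ j') (hj : j' ≤ j)
    (Qm : TorusSite 2 L) {t : ℝ} (ht : t ∈ Icc (0 : ℝ) 1) :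
    ∑ p, ‖((((klScale klE0 (n + 1) - klScale klE0 n) *
        (klBubbleMass L M β μ K
            (fun k => deriv (fun Λ' => hubbardCutoffWeightCT L M β μ K Λ' k) (klScale klE0 n + t * (klScale klE0 (n + 1) - klScale klE0 n)))
            (softSymbolCompl L M β μ K (n + 1) j - softSymbolCompl L M β μ K (n + 1) j') Qm p +
          klBubbleMass L M β μ K (softSymbolCompl L M β μ K (n + 1) j - softSymbolCompl L M β μ K (n + 1) j')
            (fun k => deriv (fun Λ' => hubbardCutoffWeightCT L M β μ K Λ' k) (klScale klE0 n + t * (klScale klE0 (n + 1) - klScale klE0 n)))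
            Qm p) : ℝ)) : ℂ)‖ ≤ (2 : ℝ) ^ 10 * klIdxMass n j' := by
  have hβ0 : 0 < β := pos_of_klBetaMin_le hβ
  refine (klmf_sum_norm_relRate_le L M β μ K hβ0 n _ _ Qm ht).trans ?_
  rw [softSymbolCompl_sub_compl_eq_sub β μ K (n + 1) n j j']
  exact mul_le_mul_of_nonneg_left (klSoftMass_compl_sub_compl_le_klIdxMass β μ K hK hβ hβL ((Nat.le_succ n).trans hn) hj) (by positivity)

end Model

end Summit.HubbardSuperconductivity.HubbardSuperconductivity.Theorems.KLRegimeSplit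

end
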